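import Literature.Geometry.Symplectic.SphereCROperatorBanach
import Literature.Analysis.Complex.RiemannSphereLevelMaps
import HarnessLib

/-!
# The chart Cauchy–Riemann operators across Hölder levels

Layer B7 (infrastructure) of the analytic core of the Hofer–Lizan–Sikorav local foliation theorem
(Wendl 2018, Thm. 2.46; lead of crux `WitnessCharge`, summit `SmoothPoincare4`). The implicit
function theorem of `SphereCRFamily.lean` produces the family of chart solutions in ONE Hölder
level `SecPair k r = 𝓗^{k+1,r}_{-w²} × 𝓗^{k+1,r}_1`; joint smoothness of the family is obtained by
running the argument in every level `k' ≥ k` and comparing the results through the level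
inclusions of `Literature/Analysis/Complex/RiemannSphereLevelMaps.lean`. This file supplies:

* `SecPair.inclLE hr h : SecPair k' r →L[ℝ] SecPair k r` (`h : k ≤ k'`) — the pair of inclusions of
  section spaces at levels `k' + 1 → k + 1`, injective, transitive, with the level lift
  `SecPair.exists_inclLE_eq` (a `y : SecPair k r` whose four pieces are `C^{k'+1,r}_b` comes from
  level `k'`);
* **compatibility of the chart Cauchy–Riemann operators of `𝒥 : SphereACData`
  (`SphereCROperatorBanach.lean`) with the level maps**: the jets (`jets₀_inclLE`), the outputs
  `out₀`, `out₁` and their derivatives `dout₀`, `dout₁`, the pieces `PT`, `PN`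
  (`PT_inclLE : PT hr k (inclLE y) = (inclLE × inclLE) (PT hr k' y)`) and their derivatives `dPT`,
  `dPN`, and the level independence of the membership of the pieces in the section spaces
  (`PT_inclLE_mem_iff`) — all are built from the same pointwise formulas in the same underlying
  functions. The section-valued operators `FT`, `FN`, the linearisations and the implicit-function
  map are treated in `SphereCRLevelsFamily.lean`.

The norm-based smallness condition `Small` is NOT level independent and is not treated here (the
pointwise condition on `sec₀`, `sec₁` is: `SecPair.sec₀_inclLE_fst`). Everything is proved; no
named facts.

## References

* C. Wendl, *Holomorphic Curves in Low Dimensions*, LNM 2216 (2018), §2.3, Thm. 2.46. [Wendl2018]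
-/

noncomputable section

open Set Filter Metric Function Complex
open scoped Topology NNReal ContDiff
open Literature.Analysis.FunctionSpaces Literature.Analysis.Complex.RiemannSphere
open Literature.Analysis.Complex Literature.Geometry.Symplectic.CRExpression

namespace Literature.Geometry.Symplectic

namespace SphereCR

/-! ### Level inclusions of the unknowns `SecPair` -/

namespace SecPair

variable {r : ℝ≥0} {k k' k'' : ℕ}

/-- **The inclusion of unknowns `SecPair k' r →L[ℝ] SecPair k r`** (`k ≤ k'`, `r ≤ 1`): the pair
of inclusions of section spaces at levels `k' + 1 → k + 1`. [folklore] -/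
def inclLE (hr : r ≤ 1) (h : k ≤ k') : SecPair k' r →L[ℝ] SecPair k r :=
  (RiemannSphere.inclLE hr (Nat.add_le_add_right h 1)).prodMap
    (RiemannSphere.inclLE hr (Nat.add_le_add_right h 1))

/-- Components of the inclusion of unknowns. [folklore] -/
theorem inclLE_apply (hr : r ≤ 1) (h : k ≤ k') (y : SecPair k' r) :
    inclLE hr h y = (RiemannSphere.inclLE hr (Nat.add_le_add_right h 1) y.1,
      RiemannSphere.inclLE hr (Nat.add_le_add_right h 1) y.2) := rfl

/-- First component of the inclusion of unknowns. [folklore] -/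
@[simp]
theorem inclLE_fst (hr : r ≤ 1) (h : k ≤ k') (y : SecPair k' r) :
    (inclLE hr h y).1 = RiemannSphere.inclLE hr (Nat.add_le_add_right h 1) y.1 := rfl

/-- Second component of the inclusion of unknowns. [folklore] -/
@[simp]
theorem inclLE_snd (hr : r ≤ 1) (h : k ≤ k') (y : SecPair k' r) :
    (inclLE hr h y).2 = RiemannSphere.inclLE hr (Nat.add_le_add_right h 1) y.2 := rfl

/-- The underlying functions of the four pieces are unchanged. [folklore] -/
theorem coe_inclLE_pieces (hr : r ≤ 1) (h : k ≤ k') (y : SecPair k' r) :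
    (((inclLE hr h y).1.1.1 : ℂ → ℂ) = y.1.1.1 ∧ ((inclLE hr h y).1.1.2 : ℂ → ℂ) = y.1.1.2) ∧
      ((inclLE hr h y).2.1.1 : ℂ → ℂ) = y.2.1.1 ∧ ((inclLE hr h y).2.1.2 : ℂ → ℂ) = y.2.1.2 :=
  ⟨⟨rfl, rfl⟩, rfl, rfl⟩

/-- The `z`-representative of the vector field is unchanged. [folklore] -/
theorem sec₀_inclLE_fst (hr : r ≤ 1) (h : k ≤ k') (y : SecPair k' r) :
    sec₀ (fun w : ℂ => -w ^ 2) (inclLE hr h y).1.1 = sec₀ (fun w : ℂ => -w ^ 2) y.1.1 := rfl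

/-- The `w`-representative of the vector field is unchanged. [folklore] -/
theorem sec₁_inclLE_fst (hr : r ≤ 1) (h : k ≤ k') (y : SecPair k' r) :
    sec₁ (fun w : ℂ => -w ^ 2) (inclLE hr h y).1.1 = sec₁ (fun w : ℂ => -w ^ 2) y.1.1 := rfl

/-- The `z`-representative of the function is unchanged. [folklore] -/
theorem sec₀_inclLE_snd (hr : r ≤ 1) (h : k ≤ k') (y : SecPair k' r) :
    sec₀ (1 : ℂ → ℂ) (inclLE hr h y).2.1 = sec₀ (1 : ℂ → ℂ) y.2.1 := rfl

/-- The `w`-representative of the function is unchanged. [folklore] -/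
theorem sec₁_inclLE_snd (hr : r ≤ 1) (h : k ≤ k') (y : SecPair k' r) :
    sec₁ (1 : ℂ → ℂ) (inclLE hr h y).2.1 = sec₁ (1 : ℂ → ℂ) y.2.1 := rfl

/-- The inclusion of unknowns is injective. [folklore] -/
theorem inclLE_injective (hr : r ≤ 1) (h : k ≤ k') : Injective (inclLE hr h) := fun y y' hy => by
  rw [inclLE_apply, inclLE_apply, Prod.mk.injEq] at hy
  exact Prod.ext (RiemannSphere.inclLE_injective hr _ hy.1)
    (RiemannSphere.inclLE_injective hr _ hy.2)

/-- The inclusion of a level into itself is the identity. [folklore] -/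
@[simp]
theorem inclLE_refl (hr : r ≤ 1) (y : SecPair k r) : inclLE hr le_rfl y = y :=
  Prod.ext (RiemannSphere.inclLE_refl hr y.1) (RiemannSphere.inclLE_refl hr y.2)

/-- Transitivity of the inclusions of unknowns. [folklore] -/
@[simp]
theorem inclLE_inclLE (hr : r ≤ 1) (h₁ : k ≤ k') (h₂ : k' ≤ k'') (y : SecPair k'' r) :
    inclLE hr h₁ (inclLE hr h₂ y) = inclLE hr (h₁.trans h₂) y :=
  Prod.ext (RiemannSphere.inclLE_inclLE hr _ _ y.1) (RiemannSphere.inclLE_inclLE hr _ _ y.2)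

/-- **Level lift of unknowns**: a `y : SecPair k r` all four of whose pieces are `C^{k'+1,r}_b` is
the image of a (unique, `inclLE_injective`) `y' : SecPair k' r`. [folklore] -/
theorem exists_inclLE_eq (hr : r ≤ 1) (h : k ≤ k') (y : SecPair k r)
    (h₁ : MemContDiffHolder (k' + 1) r (y.1.1.1 : ℂ → ℂ))
    (h₂ : MemContDiffHolder (k' + 1) r (y.1.1.2 : ℂ → ℂ))
    (h₃ : MemContDiffHolder (k' + 1) r (y.2.1.1 : ℂ → ℂ))
    (h₄ : MemContDiffHolder (k' + 1) r (y.2.1.2 : ℂ → ℂ)) :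
    ∃ y' : SecPair k' r, inclLE hr h y' = y := by
  obtain ⟨ξ, hξ⟩ := RiemannSphere.exists_inclLE_eq_of_memContDiffHolder hr
    (Nat.add_le_add_right h 1) y.1 h₁ h₂
  obtain ⟨f, hf⟩ := RiemannSphere.exists_inclLE_eq_of_memContDiffHolder hr
    (Nat.add_le_add_right h 1) y.2 h₃ h₄
  exact ⟨(ξ, f), Prod.ext hξ hf⟩

/-- The range of the inclusion of unknowns: all four pieces are `C^{k'+1,r}_b`. [folklore] -/
theorem mem_range_inclLE_iff (hr : r ≤ 1) (h : k ≤ k') (y : SecPair k r) :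
    y ∈ Set.range (inclLE hr h) ↔
      MemContDiffHolder (k' + 1) r (y.1.1.1 : ℂ → ℂ) ∧
        MemContDiffHolder (k' + 1) r (y.1.1.2 : ℂ → ℂ) ∧
        MemContDiffHolder (k' + 1) r (y.2.1.1 : ℂ → ℂ) ∧
        MemContDiffHolder (k' + 1) r (y.2.1.2 : ℂ → ℂ) := by
  constructor
  · rintro ⟨y', rfl⟩
    exact ⟨y'.1.1.1.memContDiffHolder, y'.1.1.2.memContDiffHolder, y'.2.1.1.memContDiffHolder,
      y'.2.1.2.memContDiffHolder⟩
  · rintro ⟨h₁, h₂, h₃, h₄⟩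
    exact exists_inclLE_eq hr h y h₁ h₂ h₃ h₄

end SecPair

/-! ### The jets across levels -/

section Jets

variable {r : ℝ≥0} (hr : r ≤ 1) {k k' : ℕ} (h : k ≤ k')

/-- The constant part of the jet is the same function in every level. [folklore] -/
theorem inclLE_zCutJet :
    ContDiffHolderFunction.inclLE hr h (zCutJet k' r hr) = zCutJet k r hr :=
  ContDiffHolderFunction.ext fun _ => rfl

/-- **The linear `z`-jet commutes with the level inclusions.** [folklore] -/
theorem jets₀CLM_inclLE (y : SecPair k' r) :
    jets₀CLM hr k (SecPair.inclLE hr h y) = ContDiffHolderFunction.inclLE hr h (jets₀CLM hr k' y) :=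
  ContDiffHolderFunction.ext fun _ => rfl

/-- **The linear `w`-jet commutes with the level inclusions.** [folklore] -/
theorem jets₁CLM_inclLE (y : SecPair k' r) :
    jets₁CLM hr k (SecPair.inclLE hr h y) = ContDiffHolderFunction.inclLE hr h (jets₁CLM hr k' y) :=
  ContDiffHolderFunction.ext fun _ => rfl

/-- **The `z`-jet commutes with the level inclusions.** [cite: Wendl2018, Thm. 2.46] -/
theorem jets₀_inclLE (y : SecPair k' r) :
    jets₀ hr k (SecPair.inclLE hr h y) = ContDiffHolderFunction.inclLE hr h (jets₀ hr k' y) := by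
  rw [jets₀_def, jets₀_def, map_add, jets₀CLM_inclLE, inclLE_zCutJet]

/-- **The `w`-jet commutes with the level inclusions.** [cite: Wendl2018, Thm. 2.46] -/
theorem jets₁_inclLE (y : SecPair k' r) :
    jets₁ hr k (SecPair.inclLE hr h y) = ContDiffHolderFunction.inclLE hr h (jets₁ hr k' y) := by
  rw [jets₁_def, jets₁_def, map_add, jets₁CLM_inclLE, inclLE_zCutJet]

/-- Pointwise: the `z`-jet of the included unknown is the `z`-jet. [folklore] -/
theorem jets₀_inclLE_apply (y : SecPair k' r) (z : ℂ) :
    jets₀ hr k (SecPair.inclLE hr h y) z = jets₀ hr k' y z := by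
  rw [jets₀_inclLE, ContDiffHolderFunction.inclLE_apply]

/-- Pointwise: the `w`-jet of the included unknown is the `w`-jet. [folklore] -/
theorem jets₁_inclLE_apply (y : SecPair k' r) (w : ℂ) :
    jets₁ hr k (SecPair.inclLE hr h y) w = jets₁ hr k' y w := by
  rw [jets₁_inclLE, ContDiffHolderFunction.inclLE_apply]

end Jets

/-! ### The chart Cauchy–Riemann operators across levels -/

namespace SphereACData

variable (𝒥 : SphereACData) {r : ℝ≥0} (hr : r ≤ 1) {k k' : ℕ} (h : k ≤ k')

/-- **The chart-`0` output commutes with the level inclusions**: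
`out₀ hr k (inclLE y) = inclLE (out₀ hr k' y)`. [cite: Wendl2018, Thm. 2.46] -/
theorem out₀_inclLE (y : SecPair k' r) :
    𝒥.out₀ hr k (SecPair.inclLE hr h y) = ContDiffHolderFunction.inclLE hr h (𝒥.out₀ hr k' y) :=
  ContDiffHolderFunction.ext fun z => by
    rw [out₀_apply, ContDiffHolderFunction.inclLE_apply, out₀_apply, jets₀_inclLE_apply]

/-- **The chart-`1` output commutes with the level inclusions.** [cite: Wendl2018, Thm. 2.46] -/
theorem out₁_inclLE (y : SecPair k' r) :
    𝒥.out₁ hr k (SecPair.inclLE hr h y) = ContDiffHolderFunction.inclLE hr h (𝒥.out₁ hr k' y) :=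
  ContDiffHolderFunction.ext fun w => by
    rw [out₁_apply, ContDiffHolderFunction.inclLE_apply, out₁_apply, jets₁_inclLE_apply]

/-- Pointwise form of `out₀_inclLE`. [folklore] -/
theorem out₀_inclLE_apply (y : SecPair k' r) (z : ℂ) :
    𝒥.out₀ hr k (SecPair.inclLE hr h y) z = 𝒥.out₀ hr k' y z := by
  rw [𝒥.out₀_inclLE hr h, ContDiffHolderFunction.inclLE_apply]

/-- Pointwise form of `out₁_inclLE`. [folklore] -/
theorem out₁_inclLE_apply (y : SecPair k' r) (w : ℂ) :
    𝒥.out₁ hr k (SecPair.inclLE hr h y) w = 𝒥.out₁ hr k' y w := by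
  rw [𝒥.out₁_inclLE hr h, ContDiffHolderFunction.inclLE_apply]

/-- **The derivative of the chart-`0` output commutes with the level inclusions**:
`dout₀ hr k (inclLE y) (inclLE δ) = inclLE (dout₀ hr k' y δ)`. [cite: Wendl2018, Thm. 2.46] -/
theorem dout₀_inclLE (y δ : SecPair k' r) :
    𝒥.dout₀ hr k (SecPair.inclLE hr h y) (SecPair.inclLE hr h δ) =
      ContDiffHolderFunction.inclLE hr h (𝒥.dout₀ hr k' y δ) :=
  ContDiffHolderFunction.ext fun z => by
    rw [dout₀_apply, ContDiffHolderFunction.inclLE_apply, dout₀_apply, jets₀_inclLE_apply,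
      jets₀CLM_inclLE, ContDiffHolderFunction.inclLE_apply]

/-- **The derivative of the chart-`1` output commutes with the level inclusions.**
[cite: Wendl2018, Thm. 2.46] -/
theorem dout₁_inclLE (y δ : SecPair k' r) :
    𝒥.dout₁ hr k (SecPair.inclLE hr h y) (SecPair.inclLE hr h δ) =
      ContDiffHolderFunction.inclLE hr h (𝒥.dout₁ hr k' y δ) :=
  ContDiffHolderFunction.ext fun w => by
    rw [dout₁_apply, ContDiffHolderFunction.inclLE_apply, dout₁_apply, jets₁_inclLE_apply,
      jets₁CLM_inclLE, ContDiffHolderFunction.inclLE_apply]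

/-- **The tangent pieces commute with the level inclusions**:
`PT hr k (inclLE y) = (inclLE × inclLE) (PT hr k' y)`. [cite: Wendl2018, Thm. 2.46] -/
theorem PT_inclLE (y : SecPair k' r) :
    𝒥.PT hr k (SecPair.inclLE hr h y) =
      Prod.map (ContDiffHolderFunction.inclLE hr h) (ContDiffHolderFunction.inclLE hr h)
        (𝒥.PT hr k' y) :=
  Prod.ext
    (ContDiffHolderFunction.ext fun z => by
      rw [PT_fst_apply, Prod.map_fst, ContDiffHolderFunction.inclLE_apply, PT_fst_apply,
        𝒥.out₀_inclLE_apply hr h])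
    (ContDiffHolderFunction.ext fun w => by
      rw [PT_snd_apply, Prod.map_snd, ContDiffHolderFunction.inclLE_apply, PT_snd_apply,
        𝒥.out₁_inclLE_apply hr h])

/-- **The normal pieces commute with the level inclusions.** [cite: Wendl2018, Thm. 2.46] -/
theorem PN_inclLE (y : SecPair k' r) :
    𝒥.PN hr k (SecPair.inclLE hr h y) =
      Prod.map (ContDiffHolderFunction.inclLE hr h) (ContDiffHolderFunction.inclLE hr h)
        (𝒥.PN hr k' y) :=
  Prod.ext
    (ContDiffHolderFunction.ext fun z => by
      rw [PN_fst_apply, Prod.map_fst, ContDiffHolderFunction.inclLE_apply, PN_fst_apply,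
        𝒥.out₀_inclLE_apply hr h])
    (ContDiffHolderFunction.ext fun w => by
      rw [PN_snd_apply, Prod.map_snd, ContDiffHolderFunction.inclLE_apply, PN_snd_apply,
        𝒥.out₁_inclLE_apply hr h])

/-- **The derivative of the tangent pieces commutes with the level inclusions**:
`dPT hr k (inclLE y) (inclLE δ) = (inclLE × inclLE) (dPT hr k' y δ)`. [cite: Wendl2018, Thm. 2.46] -/
theorem dPT_inclLE (y δ : SecPair k' r) :
    𝒥.dPT hr k (SecPair.inclLE hr h y) (SecPair.inclLE hr h δ) =
      Prod.map (ContDiffHolderFunction.inclLE hr h) (ContDiffHolderFunction.inclLE hr h)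
        (𝒥.dPT hr k' y δ) :=
  Prod.ext
    (ContDiffHolderFunction.ext fun z => by
      rw [dPT_apply_fst, Prod.map_fst, ContDiffHolderFunction.inclLE_apply, dPT_apply_fst,
        𝒥.dout₀_inclLE hr h, ContDiffHolderFunction.inclLE_apply])
    (ContDiffHolderFunction.ext fun w => by
      rw [dPT_apply_snd, Prod.map_snd, ContDiffHolderFunction.inclLE_apply, dPT_apply_snd,
        𝒥.dout₁_inclLE hr h, ContDiffHolderFunction.inclLE_apply])

/-- **The derivative of the normal pieces commutes with the level inclusions.**
[cite: Wendl2018, Thm. 2.46] -/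
theorem dPN_inclLE (y δ : SecPair k' r) :
    𝒥.dPN hr k (SecPair.inclLE hr h y) (SecPair.inclLE hr h δ) =
      Prod.map (ContDiffHolderFunction.inclLE hr h) (ContDiffHolderFunction.inclLE hr h)
        (𝒥.dPN hr k' y δ) :=
  Prod.ext
    (ContDiffHolderFunction.ext fun z => by
      rw [dPN_apply_fst, Prod.map_fst, ContDiffHolderFunction.inclLE_apply, dPN_apply_fst,
        𝒥.dout₀_inclLE hr h, ContDiffHolderFunction.inclLE_apply])
    (ContDiffHolderFunction.ext fun w => by
      rw [dPN_apply_snd, Prod.map_snd, ContDiffHolderFunction.inclLE_apply, dPN_apply_snd,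
        𝒥.dout₁_inclLE hr h, ContDiffHolderFunction.inclLE_apply])

/-- Membership of the tangent pieces in `𝓗T'` is level independent. [folklore] -/
theorem PT_inclLE_mem_iff (y : SecPair k' r) :
    𝒥.PT hr k (SecPair.inclLE hr h y) ∈ holderSections ℂ (dbarClutch (fun w : ℂ => -w ^ 2)) k r ↔
      𝒥.PT hr k' y ∈ holderSections ℂ (dbarClutch (fun w : ℂ => -w ^ 2)) k' r := by
  rw [𝒥.PT_inclLE hr h, RiemannSphere.prodMap_inclLE_mem_iff]

/-- Membership of the normal pieces in `𝓗N'` is level independent. [folklore] -/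
theorem PN_inclLE_mem_iff (y : SecPair k' r) :
    𝒥.PN hr k (SecPair.inclLE hr h y) ∈ holderSections ℂ (dbarClutch (1 : ℂ → ℂ)) k r ↔
      𝒥.PN hr k' y ∈ holderSections ℂ (dbarClutch (1 : ℂ → ℂ)) k' r := by
  rw [𝒥.PN_inclLE hr h, RiemannSphere.prodMap_inclLE_mem_iff]

end SphereACData

end SphereCR

end Literature.Geometry.Symplectic

end
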